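import Literature.Probability.RandomPlanarGeometry.SAWPositiveWalks
import Literature.Probability.RandomPlanarGeometry.BDGS2012CountBoundsProofs
import HarnessLib

/-!
# Proved parts of the named facts of `SelfAvoidingWalk.lean` (planar SAW, `μ(ℤ²)`)

Topic `Literature/Probability/RandomPlanarGeometry`; sibling of `SelfAvoidingWalk.lean`, which states
two named facts about the connective constant `μ = μ(ℤ²) = infₙ cₙ^{1/n}`
(`Literature.Probability.RandomPlanarGeometry.SAW.connectiveConstant`):

* `SAW.tendsto_count_rpow` (`cₙ^{1/n} → μ`, Hammersley–Morton) — DISCHARGED in `SAWCount.lean`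
  (`SAW.tendsto_count_rpow_holds`, Fekete's lemma on `log cₙ`);
* `SAW.LawlerSchrammWerner2004SAW_connectiveConstant_bounds` (`2.6 ≤ μ ≤ 2.7`, quoted by
  Lawler–Schramm–Werner 2004, §3.1, from Madras–Slade) — NOT discharged, and not expected to be
  dischargeable in the kernel: both inequalities are computer-assisted results (lower bounds by
  Kesten's irreducible-bridge method with bridge enumerations to length ≈ 40–70, Conway–Guttmann
  1993 `2.62002`, Jensen 2004 `2.625622`; upper bounds by Alm's 1993 eigenvalue method on
  `≳ 10⁹` enumerated walks, `2.6939`, Pönitz–Tittmann 2000 `2.679193`), while the elementary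
  certificates stop far short (`c₁₆^{1/16} = 2.833…` from above; Kesten's truncation at the 16-step
  irreducible bridges gives only `2.544…` from below). Its sharp form is the named fact
  `SAW.Zd.BDGS2012_connectiveConstant_two_bounds` with the proved implication
  `BDGS2012_connectiveConstant_two_bounds.lsw` (`BDGS2012.lean`).

What IS elementary and proved (Madras–Slade 1993, §1.1–1.2, eqs. (1.1.1), (1.2.2): `dⁿ ≤ cₙ`, hence
`d ≤ μ(d)`; the tree's `SAW.Zd.pow_le_count`, `SAW.Zd.natCast_le_connectiveConstant` of
`SAWPositiveWalks.lean`) is restated here for the planar constant: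

* `SAW.two_le_connectiveConstant : 2 ≤ μ(ℤ²)`;
* `SAW.criticalFugacity_pos_lt_one' : 0 < x_c ∧ x_c < 1` — the HYPOTHESIS-FREE form of
  `SAW.criticalFugacity_pos_lt_one`, which takes the quoted bounds as a hypothesis (so users of the
  critical fugacity `x_c = 1/μ` need not carry the named fact);
* `SAW.criticalFugacity_le_half : x_c ≤ 1/2`;
* (added) the UPPER elementary halves, from the non-reversing-walk bound `cₙ ≤ 2d(2d-1)^{n-1}`, i.e.
  `μ(d) ≤ 2d - 1` (BDGS 2012 (1.13) = Madras–Slade (1.2.2); the tree's `SAW.Zd.connectiveConstant_le` of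
  `BDGS2012CountBoundsProofs.lean`) at `d = 2`: `SAW.Zd.two_le_connectiveConstant_two_and_le_three :
  2 ≤ μ(ℤ²) ≤ 3`, `SAW.connectiveConstant_le_three : μ(ℤ²) ≤ 3`, `SAW.one_third_le_criticalFugacity :
  1/3 ≤ x_c` — so `μ(ℤ²) ∈ [2, 3]` and `x_c ∈ [1/3, 1/2]` unconditionally, the elementary enclosure of the
  computer-assisted `μ(ℤ²) ∈ [2.625622, 2.679193]` (BDGS 2012 (1.14): Jensen 2004 by Kesten's
  irreducible-bridge method on transfer-matrix bridge counts of span `≤ 15`, Pönitz–Tittmann 2000 by the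
  memory-`22` automaton; named fact `SAW.Zd.BDGS2012_connectiveConstant_two_bounds`, not reproved).

## References

* N. Madras, G. Slade, *The Self-Avoiding Walk*, Birkhäuser (1993), §1.1 eq. (1.1.1), §1.2
  eq. (1.2.2) and Table 1.1 (rigorous bounds and their sources).
* G. F. Lawler, O. Schramm, W. Werner, *On the scaling limit of planar self-avoiding walk*,
  Proc. Sympos. Pure Math. 72 (2004), §3.1 ("rigorously it is known to be between 2.6 and 2.7").
-/

noncomputable section

namespace Literature.Probability.RandomPlanarGeometry.SAW

/-- **`μ(ℤ²) ≥ 2`** for the planar connective constant `SAW.connectiveConstant`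
(`= Zd.connectiveConstant 2` by `rfl`, `Zd.connectiveConstant_two`): the `2ⁿ` walks with steps in
`{e₀, e₁}` are self-avoiding, so `2ⁿ ≤ cₙ` and `2 ≤ infₙ cₙ^{1/n}` (Madras–Slade (1.1.1), (1.2.2),
case `d = 2`; the tree's `Zd.natCast_le_connectiveConstant`). The elementary, proved part of the
quoted `2.6 ≤ μ ≤ 2.7`. [cite: MadrasSlade1993, §1.2, eq. (1.2.2)] -/
theorem two_le_connectiveConstant : (2 : ℝ) ≤ connectiveConstant := by
  have h := Zd.natCast_le_connectiveConstant 2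
  rwa [Zd.connectiveConstant_two, Nat.cast_ofNat] at h

/-- The planar critical fugacity `x_c = 1/μ(ℤ²)` lies in `(0, 1)` UNCONDITIONALLY (from
`μ(ℤ²) ≥ 2`): the hypothesis-free form of `criticalFugacity_pos_lt_one`, which assumes the quoted
bounds `LawlerSchrammWerner2004SAW_connectiveConstant_bounds`. [cite: MadrasSlade1993, §1.2, eq. (1.2.2)] -/
theorem criticalFugacity_pos_lt_one' : 0 < criticalFugacity ∧ criticalFugacity < 1 := by
  have h2 := two_le_connectiveConstant
  have hpos : 0 < connectiveConstant := by linarith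
  refine ⟨inv_pos.mpr hpos, ?_⟩
  rw [criticalFugacity, inv_lt_one_iff₀]
  exact Or.inr (by linarith)

/-- `x_c(ℤ²) ≤ 1/2`, from `μ(ℤ²) ≥ 2`. [cite: MadrasSlade1993, §1.2, eq. (1.2.2)] -/
theorem criticalFugacity_le_half : criticalFugacity ≤ 1 / 2 := by
  rw [criticalFugacity, one_div]
  exact inv_anti₀ two_pos two_le_connectiveConstant

/-! ### The upper elementary halves: `μ(ℤ²) ≤ 3`, `x_c ≥ 1/3` -/

/-- **`2 ≤ μ(ℤ²) ≤ 3`** for `Zd.connectiveConstant 2`: positive-step walks give `2ⁿ ≤ cₙ`, walks without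
immediate reversals give `cₙ ≤ 4·3ⁿ⁻¹`, hence `2 ≤ μ ≤ 3` (BDGS 2012 (1.13) at `d = 2`; the tree's
`Zd.BDGS2012_connectiveConstant_bounds_holds`). This is the elementary enclosure of the computer-assisted
bounds `μ(ℤ²) ∈ [2.625622, 2.679193]` of (1.14) (`Zd.BDGS2012_connectiveConstant_two_bounds`, Jensen 2004 /
Pönitz–Tittmann 2000), which are outputs of large enumerations and are not reproved in the tree.
[cite: BDGS2012, §1.3, eqs. (1.13)–(1.14)] -/
theorem _root_.Literature.Probability.RandomPlanarGeometry.SAW.Zd.two_le_connectiveConstant_two_and_le_three :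
    (2 : ℝ) ≤ Zd.connectiveConstant 2 ∧ Zd.connectiveConstant 2 ≤ 3 := by
  obtain ⟨h1, h2⟩ := Zd.BDGS2012_connectiveConstant_bounds_holds 2 (by norm_num)
  exact ⟨by exact_mod_cast h1, by norm_num at h2; exact h2⟩

/-- **`μ(ℤ²) ≤ 3`** for the planar connective constant `SAW.connectiveConstant`
(`= Zd.connectiveConstant 2`, `Zd.connectiveConstant_two`), the companion of
`two_le_connectiveConstant`: the walks without immediate reversals number `4·3ⁿ⁻¹ ≥ cₙ`
(Madras–Slade (1.2.2), upper half, case `d = 2`). [cite: MadrasSlade1993, §1.2, eq. (1.2.2)] -/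
theorem connectiveConstant_le_three : connectiveConstant ≤ 3 := by
  rw [← Zd.connectiveConstant_two]
  exact Zd.two_le_connectiveConstant_two_and_le_three.2

/-- **`1/3 ≤ x_c(ℤ²)`**, from `μ(ℤ²) ≤ 3`; with `criticalFugacity_le_half`, `x_c ∈ [1/3, 1/2]`
unconditionally (the quoted bounds put it in `[1/2.679193, 1/2.625622] ⊆ (0.373, 0.381)`).
[cite: MadrasSlade1993, §1.2, eq. (1.2.2)] -/
theorem one_third_le_criticalFugacity : 1 / 3 ≤ criticalFugacity := by
  have hpos : 0 < connectiveConstant := by linarith [two_le_connectiveConstant]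
  rw [criticalFugacity, ← one_div]
  exact one_div_le_one_div_of_le hpos connectiveConstant_le_three

end Literature.Probability.RandomPlanarGeometry.SAW
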